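import Summits.Ventures.CertifiedManyBodySolver.Certificates.HubbardSquare_U10_n7o8_tp3o10_lower_row648
import HarnessLib
import HarnessLib.Audit

/-!
# Ventures/CertifiedManyBodySolver — Certificates/HubbardSquare_n7o8_splitPlaneStation_d2_discharge_r648.lean

HONEST FRAMING: bookkeeping only. The C-134 words of this seat (`Certificates/HubbardSquare_n7o8_stiffness_splitPlaneStation_d2_{boxes_A,points_A}.lean`,
hubbard-fast-reuse-2 g13, object (M6) «7/8 column d closes with the second t′ > 0 floor») take the CERTIFIED #648 floor (10, ⅞, +3/10) BY VALUE as the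
hypothesis `h648v : −4991958258738947077587337/6044629098073145873530880 ≤ e(1, 3/10, 10, 7/8)` because lit-4's claim node did not exist at filing (17:57Z).
The node has since landed (`Certificates/HubbardSquare_U10_n7o8_tp3o10_lower_row648.lean`, sr-mbsolver-lit-4): `cert_r648_bs_GU10n7o8tp3o10_…_uprime : Prop` IS that
very inequality, so `h648v` is DISCHARGED BY NAME — the theorem below is the identity map, recorded so the link is citable (tag «#648 by value» → «#648 BY NAME»).
No number moves; no new word; not a superconductivity or `T_c` verdict; NO summit statement is proved by this seat. Zero compute, no definition, no claim node, no `sorry`.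
Cell `pub/hubbard-fast` (D-0154 (1)(A)), seat `hubbard-fast-reuse-2` g13.
-/

noncomputable section

namespace Summit.Ventures.CertifiedManyBodySolver.Certificates

open Literature.MathematicalPhysics.QuantumLattice
open Literature.MathematicalPhysics.QuantumLattice.ThermodynamicLimit

/-- **`h648v` of C-134 ≡ the claim node of CERTIFIED #648.** The by-value hypothesis of the (M6) words is the node's own sentence
(`−4991958258738947077587337/6044629098073145873530880 ≤ e₀(1, 3/10, 10, 7/8)`, print −0.8258502181): feed `h648` wherever `h648v` is asked. [folklore] -/
theorem n7o8_d2_h648v_of_node (h648 : cert_r648_bs_GU10n7o8tp3o10_w3_b4_R2_ob5p2_kry1_kry2c3rel_hanK7B4D4_KN4_PR20d4_hanK8c2s_uprime) :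
    (((-4991958258738947077587337/6044629098073145873530880 : ℚ)) : ℝ) ≤ energyDensityTT' 1 (3/10) (10) (7 / 8) := h648

end Summit.Ventures.CertifiedManyBodySolver.Certificates

end
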